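import Summits.Parity.BatemanHorn.Theorems.SoloInformedThinLocal
import HarnessLib

/-!
# Thin sequences vs. Type-I/II information, XV: Type I by good rows only

A sharper Type-I void theorem.  In `SoloInformedThinComparisonI` the rows `m` of the Type-I
sum meeting the support of `a` were estimated through a height bound `b ≤ x^η`, which cost the
coupling `γ > 1 − c + η`.  Discarding those rows instead (they contribute `≥ 0`) needs NO height
bound at all: if `b ≥ 0` puts mass `≥ x/(4p)` on the multiples in `(x/2, x]` of the primes `p ∉ Q`
of one short range `p ≤ x^κ` (`κ > 1 − c`, `#Q ≤ (log x)²`), then for every real `a` with at most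
`x^{1−c}` non-zero values on `(x/2, x]` the sequence `w = a − b` violates (I) at every level
`x^γ`, `γ > 1 − c`: among the `≍ x^{1−c'}/log x` primes `p ∈ (M, 2M]`, `M ≍ x^{1−c'}`,
`1 − c < 1 − c' < min(γ, κ)`, at most `#A · 2 log x = o(#primes)` have a multiple in the support,
and every other row contributes `|∑_n w(pn)| = ∑_n b(pn) ≥ x/(8M)`.

* `typeI_sparse_le_rows` — the explicit inequality `(#S − #A·log x/log M) · m ≤ x/(log x)^B`;
* `card_primeFactors_le_log_sq` — `#{p | q} ≤ (log x)²` for `0 < q ≤ x²`, `x ≥ e⁶`;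
* `eventually_not_typeI_of_sparse_rows`, `eventually_not_typeI_of_sparse_rows_coprime`.

References: [cite: FordMaynard2024PrimeSieves, §2.4] [cite: FordMaynard2024PrimeSieves, §1 (I)]
[cite: FordMaynard2024PrimeSieves, §4.2 (Lemma 4.6)].
-/

noncomputable section

open Filter Finset Real

namespace Summit.Parity.BatemanHorn.Theorems

open Literature.Barriers.Parity.FordMaynard (TypeI eventually_mul_rpow_le_rpow)

/-- **(I) against a thin support, good rows only.**  Let `S` be a finite set of primes
`M < p ≤ x^γ`, `A ⊇` the support of `a` on `(x/2, x]`, `b ≥ 0` with row mass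
`∑_{x/2 < pn ≤ x} b(pn) ≥ m ≥ 0` for every `p ∈ S`.  If `w = a − b` satisfies (I) at level `x^γ`,
then `(#S − #A · log x / log M) · m ≤ x/(log x)^B`. [cite: FordMaynard2024PrimeSieves, §2.4] -/
theorem typeI_sparse_le_rows {a b : ℕ → ℝ} {x γ B m : ℝ} (hB : 0 ≤ B) (hx : 1 ≤ x) {M : ℝ}
    (hM : 1 < M) (S A : Finset ℕ)
    (hS : ∀ p ∈ S, p.Prime ∧ M < (p : ℝ) ∧ (p : ℝ) ≤ x ^ γ)
    (hA : ∀ v : ℕ, x / 2 < (v : ℝ) → (v : ℝ) ≤ x → a v ≠ 0 → v ∈ A)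
    (hb0 : ∀ n, 0 ≤ b n) (hm : 0 ≤ m)
    (hmass : ∀ p ∈ S, m ≤ ∑ n ∈ (Icc 1 ⌊x⌋₊).filter
        (fun n : ℕ => x / 2 < (p * n : ℝ) ∧ (p * n : ℝ) ≤ x), b (p * n))
    (h : TypeI (fun n : ℕ => a n - b n) x γ B) :
    ((S.card : ℝ) - A.card * (Real.log x / Real.log M)) * m ≤ x / Real.log x ^ B := by
  set L := Real.log x / Real.log M with hL
  set T : Finset ℕ := Icc 1 ⌊x⌋₊ with hTdef
  set Nw : ℕ → Finset ℕ := fun p : ℕ =>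
    T.filter (fun n : ℕ => x / 2 < (p * n : ℝ) ∧ (p * n : ℝ) ≤ x) with hNw
  have key : ∑ m ∈ Icc 1 ⌊x ^ γ⌋₊, ((m.divisors.card : ℝ) ^ B) *
      |∑ n ∈ Nw m, (a (m * n) - b (m * n))| ≤ x / Real.log x ^ B := h (fun _ => (1, ⌊x⌋₊))
  -- bad primes `Sb` (some cofactor carries a non-zero value of `a`) and good primes `Sg`
  set Sb : Finset ℕ := S.filter (fun p : ℕ => ∃ r : ℕ, r ∈ T ∧
      (x / 2 < (p * r : ℝ) ∧ (p * r : ℝ) ≤ x) ∧ a (p * r) ≠ 0) with hSb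
  set Sg : Finset ℕ := S.filter (fun p : ℕ => ¬ ∃ r : ℕ, r ∈ T ∧
      (x / 2 < (p * r : ℝ) ∧ (p * r : ℝ) ≤ x) ∧ a (p * r) ≠ 0) with hSg
  have hS' : ∀ p ∈ S, p.Prime ∧ M < (p : ℝ) := fun p hp => ⟨(hS p hp).1, (hS p hp).2.1⟩
  have hSsub : S ⊆ Icc 1 ⌊x ^ γ⌋₊ := fun p hp => by
    rw [mem_Icc]; exact ⟨(hS p hp).1.one_le, Nat.le_floor (hS p hp).2.2⟩
  have hSgS : Sg ⊆ S := by rw [hSg]; exact filter_subset _ _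
  -- good primes: the Type-I term is exactly the `b`-mass on the multiples of `p`
  have hgoodterm : ∀ p ∈ Sg, ∑ n ∈ Nw p, b (p * n) ≤
      ((p.divisors.card : ℝ) ^ B) * |∑ n ∈ Nw p, (a (p * n) - b (p * n))| := by
    intro p hp
    have hp' := hp
    simp only [hSg, Finset.mem_filter] at hp'
    obtain ⟨hpS, hg⟩ := hp'
    have hpr := (hS p hpS).1
    have hzero : ∀ n ∈ Nw p, a (p * n) = 0 := by
      intro n hn
      have hn' := hn
      simp only [hNw, Finset.mem_filter] at hn'
      by_contra hne
      exact hg ⟨n, hn'.1, hn'.2, hne⟩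
    have hinner : ∑ n ∈ Nw p, (a (p * n) - b (p * n)) = -∑ n ∈ Nw p, b (p * n) := by
      rw [← Finset.sum_neg_distrib]
      refine sum_congr rfl fun n hn => ?_
      rw [hzero n hn]
      ring
    have hnn : 0 ≤ ∑ n ∈ Nw p, b (p * n) := sum_nonneg fun n _ => hb0 _
    rw [hinner, abs_neg, abs_of_nonneg hnn]
    have hcardpos : 0 < p.divisors.card :=
      Finset.card_pos.mpr ⟨1, Nat.one_mem_divisors.mpr hpr.ne_zero⟩
    have hτ1 : (1 : ℝ) ≤ (p.divisors.card : ℝ) := by exact_mod_cast hcardpos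
    have hτ : (1 : ℝ) ≤ (p.divisors.card : ℝ) ^ B := Real.one_le_rpow hτ1 hB
    exact le_mul_of_one_le_left hnn hτ
  have h1 : ∑ p ∈ Sg, ∑ n ∈ Nw p, b (p * n) ≤ x / Real.log x ^ B :=
    calc ∑ p ∈ Sg, ∑ n ∈ Nw p, b (p * n)
        ≤ ∑ p ∈ Sg, ((p.divisors.card : ℝ) ^ B) * |∑ n ∈ Nw p, (a (p * n) - b (p * n))| :=
          sum_le_sum hgoodterm
      _ ≤ ∑ m ∈ Icc 1 ⌊x ^ γ⌋₊, ((m.divisors.card : ℝ) ^ B) *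
            |∑ n ∈ Nw m, (a (m * n) - b (m * n))| :=
          sum_le_sum_of_subset_of_nonneg (hSgS.trans hSsub)
            (fun m _ _ => mul_nonneg (Real.rpow_nonneg (Nat.cast_nonneg _) _) (abs_nonneg _))
      _ ≤ x / Real.log x ^ B := key
  -- bad primes: at most `#A · L` of them
  have h2 : (Sb.card : ℝ) ≤ A.card * L :=
    card_badPrimes_le hx hM S T A Sb hS' hA (fun p hp => by
      have hp' := hp
      simp only [hSb, Finset.mem_filter] at hp'
      exact hp')
  have hcardSg : (Sg.card : ℝ) = S.card - Sb.card := by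
    have hsplit := Finset.card_filter_add_card_filter_not (s := S) (fun p : ℕ => ∃ r : ℕ,
      r ∈ T ∧ (x / 2 < (p * r : ℝ) ∧ (p * r : ℝ) ≤ x) ∧ a (p * r) ≠ 0)
    have : (Sb.card : ℝ) + Sg.card = S.card := by
      rw [hSb, hSg]; exact_mod_cast hsplit
    linarith
  have h3 : (Sg.card : ℝ) * m ≤ ∑ p ∈ Sg, ∑ n ∈ Nw p, b (p * n) := by
    rw [← nsmul_eq_mul, ← sum_const]
    exact sum_le_sum fun p hp => hmass p (hSgS hp)
  have h4 : ((S.card : ℝ) - A.card * L) * m ≤ (Sg.card : ℝ) * m := by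
    apply mul_le_mul_of_nonneg_right _ hm
    linarith
  linarith

/-- The prime divisors of `0 < q ≤ x²` number at most `log(x²)/log(3/2) ≤ 6 log x ≤ (log x)²`
for `x ≥ e⁶`. [folklore] -/
theorem card_primeFactors_le_log_sq {x : ℝ} {q : ℕ} (hx6 : Real.exp 6 ≤ x) (hq : 0 < q)
    (hqx : (q : ℝ) ≤ x ^ 2) : (q.primeFactors.card : ℝ) ≤ Real.log x ^ 2 := by
  have hx0 : 0 < x := lt_of_lt_of_le (Real.exp_pos 6) hx6
  have hlx6 : 6 ≤ Real.log x := by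
    rw [Real.le_log_iff_exp_le hx0]; exact hx6
  have hS : ∀ p ∈ q.primeFactors, p.Prime ∧ (3 / 2 : ℝ) < (p : ℝ) := by
    intro p hp
    have hpr := (Nat.mem_primeFactors.mp hp).1
    have h2 : (2 : ℝ) ≤ p := by exact_mod_cast hpr.two_le
    exact ⟨hpr, by linarith⟩
  have hcard := card_filter_prime_dvd_le (by norm_num : (1 : ℝ) < 3 / 2) hq.ne' hqx hS
  have hfilt : q.primeFactors.filter (fun p => p ∣ q) = q.primeFactors :=
    Finset.filter_true_of_mem (fun p hp => (Nat.mem_primeFactors.mp hp).2.1)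
  rw [hfilt, Real.log_pow] at hcard
  push_cast at hcard
  have hl : (1 : ℝ) / 3 ≤ Real.log (3 / 2) := by
    have h := Real.one_sub_inv_le_log_of_pos (by norm_num : (0 : ℝ) < 3 / 2)
    norm_num at h
    linarith
  have hlpos : 0 < Real.log (3 / 2) := by linarith
  have hlx0 : 0 ≤ Real.log x := by linarith
  have h6 : ((q.primeFactors.card : ℕ) : ℝ) ≤ 6 * Real.log x := by
    refine hcard.trans ?_
    rw [div_le_iff₀ hlpos]
    have := mul_le_mul_of_nonneg_left hl (by positivity : (0 : ℝ) ≤ 6 * Real.log x)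
    linarith
  have h7 : 6 * Real.log x ≤ Real.log x ^ 2 := by
    rw [sq]
    exact mul_le_mul_of_nonneg_right hlx6 hlx0
  exact h6.trans h7

/-- **No Type-I information above the density — no height condition.**  Let `0 < c ≤ 1`,
`γ > 1 − c`, `κ > 1 − c`, `B > 1`.  For all large `x`: for no real `a` with at most `x^{1−c}`
non-zero values on `(x/2, x]`, no exceptional set `Q` of at most `(log x)²` primes and no `b ≥ 0`
with `∑_{x/2 < pn ≤ x} b(pn) ≥ x/(4p)` for every prime `p ≤ x^κ`, `p ∉ Q`, does `w = a − b`
satisfy (I) at level `x^γ`. [cite: FordMaynard2024PrimeSieves, §2.4] -/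
theorem eventually_not_typeI_of_sparse_rows {c γ B κ : ℝ} (hc0 : 0 < c) (hc1 : c ≤ 1)
    (hγ : 1 - c < γ) (hB : 1 < B) (hκ : 1 - c < κ) :
    ∀ᶠ x : ℝ in atTop, ∀ (a b : ℕ → ℝ) (A Q : Finset ℕ), (A.card : ℝ) ≤ x ^ (1 - c) →
      (∀ v : ℕ, x / 2 < (v : ℝ) → (v : ℝ) ≤ x → a v ≠ 0 → v ∈ A) →
      (∀ n, 0 ≤ b n) → (Q.card : ℝ) ≤ Real.log x ^ 2 →
      (∀ p : ℕ, p.Prime → p ∉ Q → (p : ℝ) ≤ x ^ κ →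
        x / (4 * p) ≤ ∑ n ∈ (Icc 1 ⌊x⌋₊).filter
          (fun n : ℕ => x / 2 < (p * n : ℝ) ∧ (p * n : ℝ) ≤ x), b (p * n)) →
      ¬ TypeI (fun n : ℕ => a n - b n) x γ B := by
  obtain ⟨K, hK1, hK⟩ := exists_card_primes_Ioc_two_mul_ge
  have hK0 : 0 < K := by linarith
  -- the scale `M ≍ x^{e}` with `1 - c < e < min(γ, κ, 1)`
  set g : ℝ := min (min γ κ) 1 with hgdef
  have hgγ : g ≤ γ := (min_le_left _ _).trans (min_le_left _ _)
  have hgκ : g ≤ κ := (min_le_left _ _).trans (min_le_right _ _)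
  have hg1 : g ≤ 1 := min_le_right _ _
  have hcg : 1 - c < g := lt_min (lt_min hγ hκ) (by linarith)
  set e : ℝ := ((1 - c) + g) / 2 with hedef
  have hce : 1 - c < e := by rw [hedef]; linarith
  have heg : e < g := by rw [hedef]; linarith
  have he0 : 0 < e := by linarith
  have he1 : e < 1 := by linarith
  have hδ : 0 < (e - (1 - c)) / 3 := by linarith
  have he4 : 0 < e / 4 := by linarith
  filter_upwards [eventually_ge_atTop (4 : ℝ),
    eventually_mul_rpow_le_rpow 6 (by linarith : e < γ),
    eventually_mul_rpow_le_rpow 6 (by linarith : e < κ),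
    eventually_mul_rpow_le_rpow 48 he1,
    eventually_mul_rpow_le_rpow (16 * K)
      (by linarith : (1 - c) + (e - (1 - c)) / 3 + (e - (1 - c)) / 3 < e),
    (isLittleO_log_rpow_atTop hδ).bound one_pos,
    (isLittleO_log_rpow_atTop he4).bound one_pos,
    eventually_mul_rpow_le_rpow (4 * K) (by linarith : e / 4 + e / 4 + e / 4 < e),
    ((tendsto_rpow_atTop (by linarith : 0 < B - 1)).comp
      Real.tendsto_log_atTop).eventually_gt_atTop (8 * (4 * K))]
    with x hx4 e1 e1' e2 e3 elog elog2 e5 e4 a b A Q hA hcov hb0 hQ hbm hI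
  rw [Real.rpow_one] at e2
  have hx0 : 0 < x := by linarith
  have hx1 : 1 ≤ x := by linarith
  have hlx : 0 ≤ Real.log x := Real.log_nonneg hx1
  have hlogle : Real.log x ≤ x ^ ((e - (1 - c)) / 3) := by
    have := elog
    simp only [one_mul, Real.norm_eq_abs] at this
    rwa [abs_of_nonneg hlx, abs_of_nonneg (Real.rpow_nonneg hx0.le _)] at this
  have hlogle2 : Real.log x ≤ x ^ (e / 4) := by
    have := elog2
    simp only [one_mul, Real.norm_eq_abs] at this
    rwa [abs_of_nonneg hlx, abs_of_nonneg (Real.rpow_nonneg hx0.le _)] at this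
  have e4' : 8 * (4 * K) < Real.log x ^ (B - 1) := by simpa using e4
  -- the scale and the primes
  set M : ℕ := ⌊x ^ e⌋₊ + 2 with hMdef
  have hM2 : 2 ≤ M := by omega
  have hM2r : (2 : ℝ) ≤ M := by exact_mod_cast hM2
  have hMe : x ^ e < M := by
    have := Nat.lt_floor_add_one (x ^ e)
    push_cast [hMdef]
    linarith
  have hxe1 : 1 ≤ x ^ e := Real.one_le_rpow hx1 he0.le
  have hMle : (M : ℝ) ≤ 3 * x ^ e := by
    have h1 : (⌊x ^ e⌋₊ : ℝ) ≤ x ^ e := Nat.floor_le (Real.rpow_nonneg hx0.le _)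
    push_cast [hMdef]
    linarith
  set P : Finset ℕ := (Ioc M (2 * M)).filter Nat.Prime with hPdef
  set S : Finset ℕ := P.filter (fun p : ℕ => p ∉ Q) with hSdef
  have hSP : S ⊆ P := by rw [hSdef]; exact filter_subset _ _
  have hSprop : ∀ p ∈ S, p.Prime ∧ (M : ℝ) < p ∧ (p : ℝ) ≤ x ^ γ := by
    intro p hp
    have hp' := hSP hp
    rw [hPdef, mem_filter, mem_Ioc] at hp'
    obtain ⟨⟨hMp, hp2M⟩, hpr⟩ := hp'
    have hMp' : (M : ℝ) < p := by exact_mod_cast hMp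
    have hp2M' : (p : ℝ) ≤ 2 * M := by exact_mod_cast hp2M
    exact ⟨hpr, hMp', by linarith⟩
  have hSQ : ∀ p ∈ S, p ∉ Q := fun p hp => by
    have := hp; rw [hSdef, Finset.mem_filter] at this; exact this.2
  -- row masses `≥ x/(8M)` on `S`
  have hmass : ∀ p ∈ S, x / (8 * M) ≤ ∑ n ∈ (Icc 1 ⌊x⌋₊).filter
      (fun n : ℕ => x / 2 < (p * n : ℝ) ∧ (p * n : ℝ) ≤ x), b (p * n) := by
    intro p hp
    have hp2M : (p : ℝ) ≤ 2 * M := by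
      have := hSP hp; rw [hPdef, mem_filter, mem_Ioc] at this; exact_mod_cast this.1.2
    obtain ⟨hpr, _, _⟩ := hSprop p hp
    have hp0 : (0 : ℝ) < p := by exact_mod_cast hpr.pos
    have : x / (8 * M) ≤ x / (4 * p) :=
      div_le_div_of_nonneg_left hx0.le (by positivity) (by linarith)
    have hpκ : (p : ℝ) ≤ x ^ κ := by linarith [hMle, e1']
    exact this.trans (hbm p hpr (hSQ p hp) hpκ)
  have hmain := typeI_sparse_le_rows (by linarith) hx1 (by linarith : (1 : ℝ) < M) S A hSprop
    hcov hb0 (by positivity : (0 : ℝ) ≤ x / (8 * M)) hmass hI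
  -- lower bounds
  have hL : Real.log x / Real.log M ≤ 2 * Real.log x := by
    have hlogM : Real.log 2 ≤ Real.log M := Real.log_le_log two_pos hM2r
    have hl2 := Real.log_two_gt_d9
    rw [div_le_iff₀ (by linarith)]
    nlinarith
  have hcardP := hK M (by omega)
  have h2Mx : 2 * (M : ℝ) ≤ x := by linarith
  have hlog2M0 : 0 < Real.log (2 * M) := Real.log_pos (by linarith)
  have hlog2M : Real.log (2 * M) ≤ Real.log x := Real.log_le_log (by positivity) h2Mx
  have hlx0 : 0 < Real.log x := by linarith
  -- `#S ≥ M/(2K log 2M)`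
  have hl3 : Real.log x ^ 2 * (2 * K * Real.log (2 * M)) ≤ M := by
    have e5' : 4 * K * (x ^ (e / 4) * x ^ (e / 4) * x ^ (e / 4)) ≤ x ^ e := by
      rw [← Real.rpow_add hx0, ← Real.rpow_add hx0]; exact e5
    exact sq_mul_le_of_cube_le hK0.le hlog2M0.le hlog2M hlogle2 e5' hMe.le
  have hcardS : (M : ℝ) / (2 * K * Real.log (2 * M)) ≤ S.card := by
    rw [hSdef, hPdef]
    exact div_le_card_filter_not_mem hK0 hlog2M0 hcardP hQ hl3
  -- `#A · L ≤ 2 x^{1-c} log x ≤ M/(4K log 2M) ≤ #S/2`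
  have hAL : (A.card : ℝ) * (Real.log x / Real.log M) ≤ x ^ (1 - c) * (2 * Real.log x) :=
    mul_le_mul hA hL (div_nonneg hlx (Real.log_nonneg (by linarith))) (Real.rpow_nonneg hx0.le _)
  have hAL2 : x ^ (1 - c) * (2 * Real.log x) ≤ (M : ℝ) / (4 * K * Real.log (2 * M)) := by
    rw [le_div_iff₀ (by positivity)]
    have hl2 : Real.log x * Real.log (2 * M) ≤
        x ^ ((e - (1 - c)) / 3) * x ^ ((e - (1 - c)) / 3) :=
      mul_le_mul hlogle (hlog2M.trans hlogle) hlog2M0.le (Real.rpow_nonneg hx0.le _)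
    have hprod : x ^ (1 - c) * x ^ ((e - (1 - c)) / 3) * x ^ ((e - (1 - c)) / 3) =
        x ^ ((1 - c) + (e - (1 - c)) / 3 + (e - (1 - c)) / 3) := by
      rw [← Real.rpow_add hx0, ← Real.rpow_add hx0]
    have hnn : 0 ≤ x ^ (1 - c) := Real.rpow_nonneg hx0.le _
    calc x ^ (1 - c) * (2 * Real.log x) * (4 * K * Real.log (2 * M))
          = 8 * K * (x ^ (1 - c) * (Real.log x * Real.log (2 * M))) := by ring
      _ ≤ 8 * K * (x ^ (1 - c) * (x ^ ((e - (1 - c)) / 3) * x ^ ((e - (1 - c)) / 3))) :=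
          mul_le_mul_of_nonneg_left (mul_le_mul_of_nonneg_left hl2 hnn) (by positivity)
      _ = (16 * K * x ^ ((1 - c) + (e - (1 - c)) / 3 + (e - (1 - c)) / 3)) / 2 := by
          rw [← hprod]; ring
      _ ≤ x ^ e / 2 := by linarith
      _ ≤ M := by linarith
  have hhalf : (M : ℝ) / (4 * K * Real.log (2 * M)) = (M : ℝ) / (2 * K * Real.log (2 * M)) / 2 := by
    field_simp
    ring
  have hSA : (S.card : ℝ) / 2 ≤ S.card - A.card * (Real.log x / Real.log M) := by
    linarith
  -- `#S/2 · x/(8M) ≥ x/(32 K log x)`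
  have hTlow : x / (8 * (4 * K) * Real.log x) ≤ (S.card : ℝ) / 2 * (x / (8 * M)) := by
    have hMK : (M : ℝ) / (2 * K * Real.log x) ≤ S.card :=
      le_trans (div_le_div_of_nonneg_left (by positivity) (by positivity)
        (mul_le_mul_of_nonneg_left hlog2M (by positivity))) hcardS
    have hMne : (M : ℝ) ≠ 0 := by positivity
    have hlxne : Real.log x ≠ 0 := hlx0.ne'
    have hKne : K ≠ 0 := hK0.ne'
    calc x / (8 * (4 * K) * Real.log x)
          = (M : ℝ) / (2 * K * Real.log x) / 2 * (x / (8 * M)) := by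
          field_simp
          try ring
      _ ≤ S.card / 2 * (x / (8 * M)) := by
          apply mul_le_mul_of_nonneg_right _ (by positivity)
          linarith
  have hmono : (S.card : ℝ) / 2 * (x / (8 * M)) ≤
      (S.card - A.card * (Real.log x / Real.log M)) * (x / (8 * M)) :=
    mul_le_mul_of_nonneg_right hSA (by positivity)
  have hfin := div_log_rpow_lt (by positivity : 0 < 4 * K) (by linarith) e4'
  linarith

/-- **Corollary: the `(n, q) = 1` twist.**  For every modulus `0 < q ≤ x²` the exceptional set
may be taken to be the prime divisors of `q`. [cite: FordMaynard2024PrimeSieves, §4.2] -/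
theorem eventually_not_typeI_of_sparse_rows_coprime {c γ B κ : ℝ} (hc0 : 0 < c) (hc1 : c ≤ 1)
    (hγ : 1 - c < γ) (hB : 1 < B) (hκ : 1 - c < κ) :
    ∀ᶠ x : ℝ in atTop, ∀ (a b : ℕ → ℝ) (A : Finset ℕ) (q : ℕ), (A.card : ℝ) ≤ x ^ (1 - c) →
      (∀ v : ℕ, x / 2 < (v : ℝ) → (v : ℝ) ≤ x → a v ≠ 0 → v ∈ A) →
      (∀ n, 0 ≤ b n) → 0 < q → (q : ℝ) ≤ x ^ 2 →
      (∀ p : ℕ, p.Prime → ¬ p ∣ q → (p : ℝ) ≤ x ^ κ →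
        x / (4 * p) ≤ ∑ n ∈ (Icc 1 ⌊x⌋₊).filter
          (fun n : ℕ => x / 2 < (p * n : ℝ) ∧ (p * n : ℝ) ≤ x), b (p * n)) →
      ¬ TypeI (fun n : ℕ => a n - b n) x γ B := by
  filter_upwards [eventually_not_typeI_of_sparse_rows hc0 hc1 hγ hB hκ,
    eventually_ge_atTop (Real.exp 6)] with x hx hx6 a b A q hA hcov hb0 hq hqx hbm
  refine hx a b A q.primeFactors hA hcov hb0 (card_primeFactors_le_log_sq hx6 hq hqx) ?_
  intro p hpr hpQ
  exact hbm p hpr (fun hd => hpQ (Nat.mem_primeFactors.mpr ⟨hpr, hd, hq.ne'⟩))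

end Summit.Parity.BatemanHorn.Theorems

end
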